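import Mathlib
import Summits.QuantumFields.BalabanUV.Beta.UnitLatticeWalkTerms

/-!
# `Summit.QuantumFields.BalabanUV.Beta.UnitLatticeDecoratedChains` — A3-loc (iv)-core: DECORATED sums of walk terms —
# a coefficient `c(b⃗)` growing like `A₀·e^{δ·(chain separation of b⃗)}` is ABSORBED by majorising the cube-sequence
# terms at the rate `κ + δ`: `WRS_κ(Σ_{b⃗} c(b⃗)·walkTerm b⃗) ≤ A₀·N·C_L·((2N/M)·C_L·K₁^{(κ+δ)})ⁿ` — no volume factor,
# no `e^{κ₁}` per step

HONEST FRAMING (page 1 of everything in this cell).  Discharging `FlowStep.BetaPertH` would make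
Bałaban's ultraviolet stability UNCONDITIONAL — a constructive-QFT result; it is NOT the continuum
limit and NOT the Clay problem.  This module discharges nothing of `BetaPertH`; [folklore] algebra (the chain estimate
behind every «generalized random walk expansion with decorations», [II] (1.11) ∕ B9 (3.108)), kernel-checked (unit
`b2b-balaban-beta-d4-p3`, road P3, gen 3; leaf A3-loc (iv)-core of skeleton v1.7 §7.4 = the analytic half of the
owner's rider (ρ3)).  What it is FOR: the s-decorated unit-lattice resolvent `G_dec(s) = Σ_γ s^{dec(γ)}·walkTerm_γ`
on the polydisc `|s(Δ)| ≤ e^{κ₁}` has `|s^{dec(γ)}| ≤ e^{κ₁#dec(γ)} ≤ e^{κ₁c₀}·e^{(c₁κ₁/M_d)·ℓ(γ)}` (TUBE LEMMA, A3-loc (iii),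
not here), and THIS module shows that a weight `e^{δℓ(γ)}` with `ℓ(γ)` = the chain separation costs only the passage
from rate `κ + δ` to rate `κ` in the majorants.
HONEST DEPENDENCY: continuum YM on T⁴ ⇐ BetaPertH ∧ nine spine estimates (0/9 proved); BetaPertH ⇐
(D1) ∧ (D4) ∧ CAP+tail; G-an2-4 gates asym, D1 and NE2/3/4.

CONTENTS (0 sorry).
* §1 real MAJORANTS with the separation credit built in: `headMaj`, `stepMaj δ` (the commutator–local-inverse factor
  with weight `e^{δd(k,l)}` on the commutator link), `walkMaj δ n b⃗`; `sepSum sep n b⃗` (the chain separation);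
* §2 **`norm_walkTerm_le_walkMaj`**: `e^{δ·sepSum(b⃗)}·‖walkTerm n b⃗ (i,j)‖ ≤ walkMaj δ n b⃗ (i,j)` whenever
  `sep(b,b′) ≤ d(k,l)` for `k ∈ □̃_b`, `l ∈ □̃_{b′}` — the credit is paid by the commutator link, whose left index is
  pinned in the previous cube by the column support of the preceding factors (`walkTerm_apply_eq_zero_of_col`);
* §3 `sum_walkMaj_eq`: `Σ_{b⃗} walkMaj δ n b⃗ = headMajSum·(stepMajSum δ)ⁿ`; §4 `wrs_headMajSum` (≤ N·C_L),
  `wrs_stepMajSum` (≤ (2N/M)·C_L·K₁′ with `K₁′` the first exponential moment of `K′` AT RATE `κ + δ`);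
* §5 END **`wrs_decoratedSum`**: `‖c(b⃗)‖ ≤ A₀e^{δ·sepSum(b⃗)}` ⟹
  `WRS κ d (Σ_{b⃗} c(b⃗)•walkTerm n b⃗) (A₀·N·C_L·((2N/M)·C_L·K₁′)ⁿ)`.
NOT HERE: the decoration regions and the tube count (A3-loc (iii)); the near∕far refinement inside the terms (ii); any
instance.  NOT summit progress.
-/

open scoped BigOperators Matrix
open Finset Matrix

namespace Summit.QuantumFields.BalabanUV.Beta.UnitLatticeDecoratedChains

open Summit.QuantumFields.BalabanUV.Beta.UnitLatticeWalkInversion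
open Summit.QuantumFields.BalabanUV.Beta.UnitLatticeWalkTerms
open Literature.MathematicalPhysics.QuantumFieldTheory.Balaban1983to89.B13PerturbativeStep
  (wrs WRS WeightHyp wrs_mul_le wrs_add_le)

noncomputable section

variable {Y : Type*} [Fintype Y] [DecidableEq Y] {B : Type*}

/-! ## §1 Majorants with the separation credit -/

/-- Entrywise norm majorant of the head factor. [folklore] -/
def headMaj (h : B → Y → ℝ) (L : B → Matrix Y Y ℂ) (b : B) : Matrix Y Y ℝ := fun i j => ‖headFactor h L b i j‖

/-- Majorant of the step factor WITH the credit weight `e^{δd(k,l)}` on the commutator link `(k,l)`: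
`Σ_l |h_b(k) − h_b(l)|·‖K′(k,l)‖·e^{δd(k,l)}·‖(L_bH_b)(l,m)‖`. [folklore] -/
def stepMaj (δ : ℝ) (d : Y → Y → ℝ) (h : B → Y → ℝ) (K' : Matrix Y Y ℂ) (L : B → Matrix Y Y ℂ) (b : B) :
    Matrix Y Y ℝ :=
  fun k m => ∑ l, |h b k - h b l| * ‖K' k l‖ * Real.exp (δ * d k l) * ‖(L b * Hd h b) l m‖

/-- Majorant of a walk term over a cube sequence (same recursion as `walkTerm`). [folklore] -/
def walkMaj (δ : ℝ) (d : Y → Y → ℝ) (h : B → Y → ℝ) (K' : Matrix Y Y ℂ) (L : B → Matrix Y Y ℂ) :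
    (n : ℕ) → (Fin (n + 1) → B) → Matrix Y Y ℝ
  | 0, b => headMaj h L (b 0)
  | n + 1, b => walkMaj δ d h K' L n (Fin.init b) * stepMaj δ d h K' L (b (Fin.last (n + 1)))

/-- The CHAIN SEPARATION of a cube sequence: `Σ_t sep(b_{t−1}, b_t)` (same recursion). [folklore] -/
def sepSum (sep : B → B → ℝ) : (n : ℕ) → (Fin (n + 1) → B) → ℝ
  | 0, _ => 0
  | n + 1, b => sepSum sep n (Fin.init b) + sep (b (Fin.last n).castSucc) (b (Fin.last (n + 1)))

omit [Fintype Y] [DecidableEq Y] in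
/-- `sepSum ≥ 0` for a nonnegative separation. [folklore] -/
theorem sepSum_nonneg (sep : B → B → ℝ) (hsep : ∀ b b', 0 ≤ sep b b') :
    ∀ (n : ℕ) (b : Fin (n + 1) → B), 0 ≤ sepSum sep n b
  | 0, _ => le_rfl
  | n + 1, b => add_nonneg (sepSum_nonneg sep hsep n (Fin.init b)) (hsep _ _)

/-! ## §2 Domination with credit -/

/-- Rows of `L_bH_b` outside `□̃_b` vanish when `P_bL_b = L_b`. [folklore] -/
theorem LH_apply_eq_zero (h : B → Y → ℝ) (E : B → Finset Y) (L : B → Matrix Y Y ℂ)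
    (hPL : ∀ b, Pj E b * L b = L b) (b : B) {l : Y} (hl : l ∉ E b) (m : Y) : (L b * Hd h b) l m = 0 := by
  have hrow : ∀ m', L b l m' = 0 := fun m' => by
    have := congrArg (fun M => M l m') (hPL b)
    simp only [Pj, Matrix.diagonal_mul, hl, if_false, zero_mul] at this
    exact this.symm
  rw [Matrix.mul_apply]
  exact Finset.sum_eq_zero fun m' _ => by rw [hrow m', zero_mul]

/-- The step factor's entries are dominated by `stepMaj 0`, and — when the LEFT index is pinned in a cube `□̃_{b′}` with
`sep(b′,b) ≤ d(k,l)` for `l ∈ □̃_b` — `e^{δ·sep(b′,b)}·‖stepFactor b (k,m)‖ ≤ stepMaj δ b (k,m)`. [folklore] -/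
theorem norm_stepFactor_le (h : B → Y → ℝ) (E : B → Finset Y) (K' : Matrix Y Y ℂ) (L : B → Matrix Y Y ℂ)
    (hPL : ∀ b, Pj E b * L b = L b) {δ : ℝ} (hδ : 0 ≤ δ) (d : Y → Y → ℝ) (sep : B → B → ℝ)
    (hsep : ∀ b b' k l, k ∈ E b → l ∈ E b' → sep b b' ≤ d k l) {b' b : B} {k : Y} (hk : k ∈ E b') (m : Y) :
    Real.exp (δ * sep b' b) * ‖stepFactor h K' L b k m‖ ≤ stepMaj δ d h K' L b k m := by
  rw [stepFactor, Matrix.mul_assoc, Matrix.mul_apply, stepMaj]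
  have hC : ∀ l, ‖(Hd h b * K' - K' * Hd h b) k l‖ = |h b k - h b l| * ‖K' k l‖ := fun l => by
    rw [comm_apply, norm_mul, ← Complex.ofReal_sub, Complex.norm_real, Real.norm_eq_abs]
  calc Real.exp (δ * sep b' b) * ‖∑ l, (Hd h b * K' - K' * Hd h b) k l * (L b * Hd h b) l m‖
      ≤ Real.exp (δ * sep b' b) * ∑ l, ‖(Hd h b * K' - K' * Hd h b) k l‖ * ‖(L b * Hd h b) l m‖ := by
        refine mul_le_mul_of_nonneg_left ?_ (Real.exp_pos _).le
        exact (norm_sum_le _ _).trans (le_of_eq (Finset.sum_congr rfl fun l _ => norm_mul _ _))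
    _ = ∑ l, Real.exp (δ * sep b' b) * (|h b k - h b l| * ‖K' k l‖ * ‖(L b * Hd h b) l m‖) := by
        rw [Finset.mul_sum]
        exact Finset.sum_congr rfl fun l _ => by rw [hC l]
    _ ≤ ∑ l, |h b k - h b l| * ‖K' k l‖ * Real.exp (δ * d k l) * ‖(L b * Hd h b) l m‖ := by
        refine Finset.sum_le_sum fun l _ => ?_
        by_cases hl : l ∈ E b
        · have hcredit : Real.exp (δ * sep b' b) ≤ Real.exp (δ * d k l) :=
            Real.exp_le_exp.2 (mul_le_mul_of_nonneg_left (hsep b' b k l hk hl) hδ)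
          have h0 : 0 ≤ |h b k - h b l| * ‖K' k l‖ * ‖(L b * Hd h b) l m‖ := by positivity
          calc Real.exp (δ * sep b' b) * (|h b k - h b l| * ‖K' k l‖ * ‖(L b * Hd h b) l m‖)
              ≤ Real.exp (δ * d k l) * (|h b k - h b l| * ‖K' k l‖ * ‖(L b * Hd h b) l m‖) :=
                mul_le_mul_of_nonneg_right hcredit h0
            _ = |h b k - h b l| * ‖K' k l‖ * Real.exp (δ * d k l) * ‖(L b * Hd h b) l m‖ := by ring
        · rw [LH_apply_eq_zero h E L hPL b hl m, norm_zero]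
          simp

/-- **DOMINATION WITH CREDIT**: `e^{δ·sepSum(b⃗)}·‖walkTerm n b⃗ (i,j)‖ ≤ walkMaj δ n b⃗ (i,j)`. [folklore] -/
theorem norm_walkTerm_le_walkMaj (h : B → Y → ℝ) (E : B → Finset Y) (hsupp : ∀ b y, y ∉ E b → h b y = 0)
    (K' : Matrix Y Y ℂ) (L : B → Matrix Y Y ℂ) (hPL : ∀ b, Pj E b * L b = L b) {δ : ℝ} (hδ : 0 ≤ δ)
    (d : Y → Y → ℝ) (sep : B → B → ℝ) (hsep0 : ∀ b b', 0 ≤ sep b b')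
    (hsep : ∀ b b' k l, k ∈ E b → l ∈ E b' → sep b b' ≤ d k l) :
    ∀ (n : ℕ) (b : Fin (n + 1) → B) (i j : Y),
      Real.exp (δ * sepSum sep n b) * ‖walkTerm h K' L n b i j‖ ≤ walkMaj δ d h K' L n b i j
  | 0, b, i, j => by simp [sepSum, walkMaj, headMaj, walkTerm]
  | n + 1, b, i, j => by
      rw [walkTerm, walkMaj, sepSum, Matrix.mul_apply, Matrix.mul_apply, mul_add, Real.exp_add]
      -- split the credit: e^{δ S_n} to the prefix, e^{δ sep} to the last step
      have hlast : (Fin.init b) (Fin.last n) = b (Fin.last n).castSucc := rfl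
      calc Real.exp (δ * sepSum sep n (Fin.init b)) * Real.exp (δ * sep (b (Fin.last n).castSucc) (b (Fin.last (n + 1))))
            * ‖∑ k, walkTerm h K' L n (Fin.init b) i k * stepFactor h K' L (b (Fin.last (n + 1))) k j‖
          ≤ Real.exp (δ * sepSum sep n (Fin.init b)) * Real.exp (δ * sep (b (Fin.last n).castSucc) (b (Fin.last (n + 1))))
            * ∑ k, ‖walkTerm h K' L n (Fin.init b) i k‖ * ‖stepFactor h K' L (b (Fin.last (n + 1))) k j‖ := by
            refine mul_le_mul_of_nonneg_left ?_ (by positivity)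
            exact (norm_sum_le _ _).trans (le_of_eq (Finset.sum_congr rfl fun k _ => norm_mul _ _))
        _ = ∑ k, (Real.exp (δ * sepSum sep n (Fin.init b)) * ‖walkTerm h K' L n (Fin.init b) i k‖)
            * (Real.exp (δ * sep (b (Fin.last n).castSucc) (b (Fin.last (n + 1))))
              * ‖stepFactor h K' L (b (Fin.last (n + 1))) k j‖) := by
            rw [Finset.mul_sum]
            refine Finset.sum_congr rfl fun k _ => ?_
            ring
        _ ≤ ∑ k, walkMaj δ d h K' L n (Fin.init b) i k * stepMaj δ d h K' L (b (Fin.last (n + 1))) k j := by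
            refine Finset.sum_le_sum fun k _ => ?_
            by_cases hk : k ∈ E ((Fin.init b) (Fin.last n))
            · rw [hlast] at hk
              exact mul_le_mul (norm_walkTerm_le_walkMaj h E hsupp K' L hPL hδ d sep hsep0 hsep n _ i k)
                (norm_stepFactor_le h E K' L hPL hδ d sep hsep hk j) (by positivity)
                ((by positivity : (0 : ℝ) ≤ _).trans
                  (norm_walkTerm_le_walkMaj h E hsupp K' L hPL hδ d sep hsep0 hsep n _ i k))
            · -- the prefix vanishes at columns outside the last cube of the prefix
              rw [walkTerm_apply_eq_zero_of_col h E hsupp K' L n (Fin.init b) i k hk, norm_zero, mul_zero, zero_mul]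
              exact mul_nonneg
                ((by positivity : (0 : ℝ) ≤ _).trans
                  (norm_walkTerm_le_walkMaj h E hsupp K' L hPL hδ d sep hsep0 hsep n _ i k))
                (Finset.sum_nonneg fun l _ => by positivity)

/-! ## §3 Recombination of the majorants over cube sequences -/

/-- `headMajSum = Σ_b headMaj b`, `stepMajSum δ = Σ_b stepMaj δ b`. [folklore] -/
def headMajSum [Fintype B] (h : B → Y → ℝ) (L : B → Matrix Y Y ℂ) : Matrix Y Y ℝ := ∑ b, headMaj h L b

/-- The summed step majorant at credit rate `δ`. [folklore] -/
def stepMajSum [Fintype B] (δ : ℝ) (d : Y → Y → ℝ) (h : B → Y → ℝ) (K' : Matrix Y Y ℂ) (L : B → Matrix Y Y ℂ) :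
    Matrix Y Y ℝ := ∑ b, stepMaj δ d h K' L b

/-- Unfolding `walkMaj` at a snoc-extended sequence. [folklore] -/
theorem walkMaj_snoc (δ : ℝ) (d : Y → Y → ℝ) (h : B → Y → ℝ) (K' : Matrix Y Y ℂ) (L : B → Matrix Y Y ℂ) (n : ℕ)
    (b : Fin (n + 1) → B) (c : B) :
    walkMaj δ d h K' L (n + 1) (Fin.snoc b c) = walkMaj δ d h K' L n b * stepMaj δ d h K' L c := by
  rw [walkMaj, Fin.init_snoc, Fin.snoc_last]

/-- **`headMajSum·(stepMajSum δ)ⁿ = Σ_{b⃗} walkMaj δ n b⃗`** (same induction as `UnitLatticeWalkTerms.Ptot_mul_Rem_pow`).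
[folklore] -/
theorem sum_walkMaj_eq [Fintype B] (δ : ℝ) (d : Y → Y → ℝ) (h : B → Y → ℝ) (K' : Matrix Y Y ℂ)
    (L : B → Matrix Y Y ℂ) :
    ∀ n : ℕ, headMajSum h L * stepMajSum δ d h K' L ^ n = ∑ b : Fin (n + 1) → B, walkMaj δ d h K' L n b
  | 0 => by
      rw [pow_zero, Matrix.mul_one, headMajSum]
      exact (Equiv.sum_comp (Equiv.funUnique (Fin 1) B) (fun b => headMaj h L b)).symm
  | n + 1 => by
      rw [pow_succ, ← Matrix.mul_assoc, sum_walkMaj_eq δ d h K' L n, stepMajSum, Finset.sum_mul_sum]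
      rw [← Equiv.sum_comp (Fin.snocEquiv fun _ => B) (fun b' => walkMaj δ d h K' L (n + 1) b'),
        Fintype.sum_prod_type]
      rw [Finset.sum_comm]
      refine Finset.sum_congr rfl fun c _ => Finset.sum_congr rfl fun b _ => ?_
      exact (walkMaj_snoc δ d h K' L n b c).symm

/-! ## §4 Weighted row sums of the summed majorants -/

section Wrs

variable {κ : ℝ} {d : Y → Y → ℝ}

omit [DecidableEq Y] in
/-- `wrs` of a finite sum of real matrices is at most the sum of the `wrs`. [folklore] -/
theorem wrs_sum_le_real {ι : Type*} (s : Finset ι) (A : ι → Matrix Y Y ℝ) (i : Y) :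
    wrs κ d (∑ c ∈ s, A c) i ≤ ∑ c ∈ s, wrs κ d (A c) i := by
  classical
  induction s using Finset.induction_on with
  | empty => simp [wrs]
  | insert a s ha ih =>
      rw [Finset.sum_insert ha, Finset.sum_insert ha]
      exact (wrs_add_le _ _ _).trans (add_le_add le_rfl ih)

/-- `wrs κ d (headMaj b) i = wrs κ d (headFactor b) i` (norm of a norm). [folklore] -/
theorem wrs_headMaj (h : B → Y → ℝ) (L : B → Matrix Y Y ℂ) (b : B) (i : Y) :
    wrs κ d (headMaj h L b) i = wrs κ d (headFactor h L b) i := by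
  simp [wrs, headMaj]

/-- **`WRS κ d headMajSum ≤ N·C_L`** (as `UnitLatticeWalkInversion.wrs_Ptot`). [folklore] -/
theorem wrs_headMajSum [Fintype B] (h : B → Y → ℝ) (E : B → Finset Y) (L : B → Matrix Y Y ℂ)
    (hsupp : ∀ b y, y ∉ E b → h b y = 0) (habs : ∀ b y, |h b y| ≤ 1) {N C_L : ℝ} (hC : 0 ≤ C_L)
    (hN : ∀ y, ((Finset.univ.filter fun b => y ∈ E b).card : ℝ) ≤ N) (hL : ∀ b, WRS κ d (L b) C_L) :
    WRS κ d (headMajSum h L) (N * C_L) := by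
  intro i
  calc wrs κ d (headMajSum h L) i ≤ ∑ b, wrs κ d (headMaj h L b) i := wrs_sum_le_real _ _ i
    _ = ∑ b, wrs κ d (headFactor h L b) i := Finset.sum_congr rfl fun b _ => wrs_headMaj h L b i
    _ ≤ ∑ b, |h b i| * C_L := Finset.sum_le_sum fun b _ =>
        (wrs_Hd_mul_mul_Hd_le h habs b (L b) i).trans (mul_le_mul_of_nonneg_left (hL b i) (abs_nonneg _))
    _ = (∑ b, |h b i|) * C_L := by rw [Finset.sum_mul]
    _ ≤ N * C_L := mul_le_mul_of_nonneg_right ((sum_abs_h_le h E hsupp habs i).trans (hN i)) hC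

/-- `wrs` of one step majorant: `≤ Σ_l |h_b(k) − h_b(l)|·‖K′(k,l)‖·e^{(κ+δ)d(k,l)}·C_L`. [folklore] -/
theorem wrs_stepMaj_le (hw : WeightHyp κ d) {δ : ℝ} (h : B → Y → ℝ) (habs : ∀ b y, |h b y| ≤ 1) (K' : Matrix Y Y ℂ)
    (L : B → Matrix Y Y ℂ) {C_L : ℝ} (hL : ∀ b, WRS κ d (L b) C_L) (b : B) (k : Y) :
    wrs κ d (stepMaj δ d h K' L b) k ≤ ∑ l, |h b k - h b l| * ‖K' k l‖ * Real.exp ((κ + δ) * d k l) * C_L := by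
  have hexp : ∀ l m, Real.exp (κ * d k m) ≤ Real.exp (κ * d k l) * Real.exp (κ * d l m) := fun l m => by
    rw [← Real.exp_add]; exact Real.exp_le_exp.2 (by nlinarith [hw.tri k l m, hw.κ_nonneg])
  have hLH : ∀ l, wrs κ d (L b * Hd h b) l ≤ C_L := fun l => (wrs_mul_Hd_le h habs b (L b) l).trans (hL b l)
  calc wrs κ d (stepMaj δ d h K' L b) k
      = ∑ m, ‖∑ l, |h b k - h b l| * ‖K' k l‖ * Real.exp (δ * d k l) * ‖(L b * Hd h b) l m‖‖ * Real.exp (κ * d k m) := rfl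
    _ ≤ ∑ m, ∑ l, |h b k - h b l| * ‖K' k l‖ * Real.exp (δ * d k l) * (‖(L b * Hd h b) l m‖
          * (Real.exp (κ * d k l) * Real.exp (κ * d l m))) := by
        refine Finset.sum_le_sum fun m _ => ?_
        rw [Real.norm_of_nonneg (Finset.sum_nonneg fun l _ => by positivity), Finset.sum_mul]
        refine Finset.sum_le_sum fun l _ => ?_
        have h0 : 0 ≤ |h b k - h b l| * ‖K' k l‖ * Real.exp (δ * d k l) * ‖(L b * Hd h b) l m‖ := by positivity
        calc |h b k - h b l| * ‖K' k l‖ * Real.exp (δ * d k l) * ‖(L b * Hd h b) l m‖ * Real.exp (κ * d k m)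
            ≤ |h b k - h b l| * ‖K' k l‖ * Real.exp (δ * d k l) * ‖(L b * Hd h b) l m‖
                * (Real.exp (κ * d k l) * Real.exp (κ * d l m)) := mul_le_mul_of_nonneg_left (hexp l m) h0
          _ = _ := by ring
    _ = ∑ l, |h b k - h b l| * ‖K' k l‖ * Real.exp ((κ + δ) * d k l) * wrs κ d (L b * Hd h b) l := by
        rw [Finset.sum_comm]
        refine Finset.sum_congr rfl fun l _ => ?_
        rw [wrs, Finset.mul_sum]
        refine Finset.sum_congr rfl fun m _ => ?_
        have : Real.exp ((κ + δ) * d k l) = Real.exp (δ * d k l) * Real.exp (κ * d k l) := by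
          rw [← Real.exp_add]; ring_nf
        rw [this]; ring
    _ ≤ ∑ l, |h b k - h b l| * ‖K' k l‖ * Real.exp ((κ + δ) * d k l) * C_L :=
        Finset.sum_le_sum fun l _ => mul_le_mul_of_nonneg_left (hLH l) (by positivity)

/-- **`WRS κ d (stepMajSum δ) ≤ (2N/M)·C_L·K₁′`** with `K₁′ ≥ Σ_j ‖K′(i,j)‖ d(i,j) e^{(κ+δ)d(i,j)}` — the first exponential
moment AT RATE `κ + δ` (as `UnitLatticeWalkInversion.wrs_Rem`, the credit folded into the moment). [folklore] -/
theorem wrs_stepMajSum [Fintype B] (hw : WeightHyp κ d) {δ : ℝ} (K' : Matrix Y Y ℂ) (h : B → Y → ℝ)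
    (E : B → Finset Y) (L : B → Matrix Y Y ℂ) (hsupp : ∀ b y, y ∉ E b → h b y = 0) (habs : ∀ b y, |h b y| ≤ 1)
    {M N C_L K₁ : ℝ} (hM : 0 < M) (hLip : ∀ b y y', |h b y - h b y'| ≤ d y y' / M)
    (hN : ∀ y, ((Finset.univ.filter fun b => y ∈ E b).card : ℝ) ≤ N) (hC : 0 ≤ C_L)
    (hL : ∀ b, WRS κ d (L b) C_L) (hK₁ : ∀ i, ∑ j, ‖K' i j‖ * d i j * Real.exp ((κ + δ) * d i j) ≤ K₁) :
    WRS κ d (stepMajSum δ d h K' L) (2 * N / M * C_L * K₁) := by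
  intro k
  calc wrs κ d (stepMajSum δ d h K' L) k
      ≤ ∑ b, wrs κ d (stepMaj δ d h K' L b) k := wrs_sum_le_real _ _ k
    _ ≤ ∑ b, ∑ l, |h b k - h b l| * ‖K' k l‖ * Real.exp ((κ + δ) * d k l) * C_L :=
        Finset.sum_le_sum fun b _ => wrs_stepMaj_le hw h habs K' L hL b k
    _ = ∑ l, (∑ b, |h b k - h b l|) * (‖K' k l‖ * Real.exp ((κ + δ) * d k l) * C_L) := by
        rw [Finset.sum_comm]
        refine Finset.sum_congr rfl fun l _ => ?_
        rw [Finset.sum_mul]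
        refine Finset.sum_congr rfl fun b _ => ?_
        ring
    _ ≤ ∑ l, (2 * N * d k l / M) * (‖K' k l‖ * Real.exp ((κ + δ) * d k l) * C_L) :=
        Finset.sum_le_sum fun l _ => mul_le_mul_of_nonneg_right
          (sum_abs_h_sub_le h E hsupp hM hLip hw.nonneg hN k l) (by positivity)
    _ = 2 * N / M * C_L * ∑ l, ‖K' k l‖ * d k l * Real.exp ((κ + δ) * d k l) := by
        rw [Finset.mul_sum]
        refine Finset.sum_congr rfl fun l _ => ?_
        ring
    _ ≤ 2 * N / M * C_L * K₁ := by
        have hN0 : 0 ≤ N := le_trans (by positivity) (hN k)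
        exact mul_le_mul_of_nonneg_left (hK₁ k) (by positivity)

/-! ## §5 END: decorated sums of walk terms -/

/-- **DECORATED SUMS OF WALK TERMS.**  Coefficients with `‖c(b⃗)‖ ≤ A₀·e^{δ·sepSum(b⃗)}` (`A₀ ≥ 0`, `δ ≥ 0`, separation
`sep(b,b′) ≤ d(k,l)` on `□̃_b × □̃_{b′}`); partition data with overlap `N` and Lipschitz `1/M`; local inverses with
`P_□L_□ = L_□` and budget `C_L`; first exponential moment `K₁′` of `K′` at rate `κ + δ`.  Then
`WRS κ d (Σ_{b⃗} c(b⃗)•walkTerm n b⃗) (A₀·(N·C_L)·((2N/M)·C_L·K₁′)ⁿ)` — uniformly in the «volume» `|B|`, with NO `e^{δ}` per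
step: the decoration growth is absorbed by the rate. [folklore] -/
theorem wrs_decoratedSum [Fintype B] (hw : WeightHyp κ d) (K' : Matrix Y Y ℂ) (h : B → Y → ℝ) (E : B → Finset Y)
    (L : B → Matrix Y Y ℂ) (hsupp : ∀ b y, y ∉ E b → h b y = 0) (habs : ∀ b y, |h b y| ≤ 1)
    (hPL : ∀ b, Pj E b * L b = L b) {M N C_L K₁ δ A₀ : ℝ} (hM : 0 < M)
    (hLip : ∀ b y y', |h b y - h b y'| ≤ d y y' / M) (hN : ∀ y, ((Finset.univ.filter fun b => y ∈ E b).card : ℝ) ≤ N)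
    (hC : 0 ≤ C_L) (hL : ∀ b, WRS κ d (L b) C_L) (hδ : 0 ≤ δ) (hA₀ : 0 ≤ A₀)
    (hK₁ : ∀ i, ∑ j, ‖K' i j‖ * d i j * Real.exp ((κ + δ) * d i j) ≤ K₁)
    (sep : B → B → ℝ) (hsep0 : ∀ b b', 0 ≤ sep b b') (hsep : ∀ b b' k l, k ∈ E b → l ∈ E b' → sep b b' ≤ d k l)
    (n : ℕ) (c : (Fin (n + 1) → B) → ℂ) (hc : ∀ b, ‖c b‖ ≤ A₀ * Real.exp (δ * sepSum sep n b)) :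
    WRS κ d (∑ b : Fin (n + 1) → B, c b • walkTerm h K' L n b) (A₀ * (N * C_L) * (2 * N / M * C_L * K₁) ^ n) := by
  -- entrywise: ‖Σ c T‖ ≤ A₀ · Σ walkMaj = A₀ · (P♯ R♯ⁿ)
  have hmaj : ∀ i j, ‖(∑ b : Fin (n + 1) → B, c b • walkTerm h K' L n b) i j‖
      ≤ A₀ * (headMajSum h L * stepMajSum δ d h K' L ^ n) i j := by
    intro i j
    rw [sum_walkMaj_eq δ d h K' L n, Matrix.sum_apply, Matrix.sum_apply, Finset.mul_sum]
    refine (norm_sum_le _ _).trans (Finset.sum_le_sum fun b _ => ?_)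
    rw [Matrix.smul_apply, smul_eq_mul, norm_mul]
    calc ‖c b‖ * ‖walkTerm h K' L n b i j‖
        ≤ A₀ * Real.exp (δ * sepSum sep n b) * ‖walkTerm h K' L n b i j‖ :=
          mul_le_mul_of_nonneg_right (hc b) (norm_nonneg _)
      _ = A₀ * (Real.exp (δ * sepSum sep n b) * ‖walkTerm h K' L n b i j‖) := by ring
      _ ≤ A₀ * walkMaj δ d h K' L n b i j :=
          mul_le_mul_of_nonneg_left (norm_walkTerm_le_walkMaj h E hsupp K' L hPL hδ d sep hsep0 hsep n b i j) hA₀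
  -- row sums of the majorant product at rate κ
  have hPR : WRS κ d (headMajSum h L * stepMajSum δ d h K' L ^ n) ((N * C_L) * (2 * N / M * C_L * K₁) ^ n) :=
    (wrs_headMajSum h E L hsupp habs hC hN hL).mul hw ((wrs_stepMajSum hw K' h E L hsupp habs hM hLip hN hC hL hK₁).pow hw n)
  have hnonneg : ∀ i j, 0 ≤ (headMajSum h L * stepMajSum δ d h K' L ^ n) i j := by
    intro i j
    rw [sum_walkMaj_eq δ d h K' L n, Matrix.sum_apply]
    exact Finset.sum_nonneg fun b _ => le_trans (by positivity)
      (norm_walkTerm_le_walkMaj h E hsupp K' L hPL hδ d sep hsep0 hsep n b i j)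
  refine WRS.of_majorant hmaj fun i => ?_
  calc ∑ j, A₀ * (headMajSum h L * stepMajSum δ d h K' L ^ n) i j * Real.exp (κ * d i j)
      = A₀ * wrs κ d (headMajSum h L * stepMajSum δ d h K' L ^ n) i := by
        rw [wrs, Finset.mul_sum]
        refine Finset.sum_congr rfl fun j _ => ?_
        rw [Real.norm_of_nonneg (hnonneg i j)]
        ring
    _ ≤ A₀ * ((N * C_L) * (2 * N / M * C_L * K₁) ^ n) := mul_le_mul_of_nonneg_left (hPR i) hA₀
    _ = A₀ * (N * C_L) * (2 * N / M * C_L * K₁) ^ n := by ring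

end Wrs

end

end Summit.QuantumFields.BalabanUV.Beta.UnitLatticeDecoratedChains
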